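import Literature.Geometry.Kaehler.ComplexTorusHilbertModularCuspStabilizerSectors
import Literature.Geometry.Kaehler.ComplexTorusHilbertModularCuspSectorGeneral
import HarnessLib

/-!
# The character kill: sector pieces with a non-trivial multiplier character are cohomologous to zero
# (Freitag, *Hilbert Modular Forms*, Ch. III §2, proof of Prop. 2.1, p. 145)

Geometry/Kaehler ∕ NumberTheory/Automorphic support file, sequel of `…CuspStabilizerSectors` (the sector pieces
`sectorPiece ω I` of an `x`-independent closed `Γ_∞`-invariant form: invariant, closed, `[ω] = Σ_I [ω_I]`) and of
`…CuspStabilizerDilationInvariance` (`[δ_ℓ^* ω] = [ω]` for the dilations `δ_ℓ : (x, y) ↦ (x, e^ℓ y)`). Everything proved;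
one definition with body (`sectorChar`), no named fact.

Freitag (p. 145): the form is invariant under `z ↦ εz + b` for the multipliers `ε ∈ Λ`; on the term `f_{ab} dx_a ∧ dy_b/y_b`
this acts through the character `Π_{σ ∈ a} σ(ε)`, and only the sectors on which all these characters are trivial can
carry cohomology. Here:

* §1 the sector character `sectorChar I ε = Π_{σ ∈ I} σ(ε)` and `Π_i charFactor ε (c_i) = sectorChar (xPart t) ε` for the
  symbol list `c` of `t` (`prod_charFactor_frameSymbols`);
* §2 for `ε = e²` with `(e m; 0 e⁻¹) ∈ Γ` the dilation `δ_{log ε}` differs from `z ↦ εz + em` by a real translation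
  (`dilateL_logEmb_eq`), so for an `x`-independent invariant `ω` the coefficients satisfy
  `f_t(δ_{log ε} z) = (sectorChar (xPart t) ε)⁻¹ f_t(z)` (`formCoeff_dilateL_logEmb`) and
  **`δ_{log ε}^* (sectorPiece ω I) = (sectorChar I ε)⁻¹ • sectorPiece ω I`** (`dilPullback_logEmb_sectorPiece`);
* §3 **`[sectorPiece ω I] = 0` in `H^{k+1}((ℍⁿ, Γ_∞))` whenever `sectorChar I ε ≠ 1` for some multiplier `ε`**
  (`mk_sectorPiece_eq_zero_of_sectorChar_ne_one`, from `mk_dilPullback_eq`), and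
  `[ω] = Σ_{I : ∀ ε ∈ Λ, sectorChar I ε = 1} [sectorPiece ω I]` (`mk_eq_sum_filter_mk_sectorPiece`);
* §4 the regulator step for a group with cusp `∞` (`HasCuspInfty Γ`): **if `sectorChar I ε = 1` for all multipliers
  `ε` then `I = ∅` or `I = Hom(F, ℝ)`** (`eq_empty_or_eq_univ_of_forall_sectorChar_eq_one`) — the functional
  `ℓ ↦ Σ_{σ ∈ I} ℓ_σ` vanishes on `log Λ`, which spans the trace-zero hyperplane
  (`HasCuspInfty.span_logMultiplierLattice_eq_top`), so it is a multiple of the trace; hence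
  **`[ω] = [ω_∅] + [ω_{Hom(F,ℝ)}]`** for `x`-independent `ω ∈ closedForms Γ_∞ (k+1)` (`mk_eq_mk_sectorPiece_empty_add_univ`).

## References

* [Freitag1990] E. Freitag, *Hilbert Modular Forms*, Springer (1990): Ch. III §2, proof of Prop. 2.1, p. 145; Ch. I §2
  Remark 2.3, p. 27.
-/

noncomputable section

/- Instance search through the form spaces `Point F [⋀^Fin p]→L[ℝ] ℂ` nests pending instance problems three deep
(see `…HilbertModularInvariantForms`). -/
set_option maxSynthPendingDepth 3

open scoped Matrix MatrixGroups Classical Topology ContDiff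

open Set Function Filter Complex ContinuousAlternatingMap

namespace Literature.NumberTheory.Automorphic.HilbertModular

open _root_.NumberField _root_.NumberField.InfinitePlace _root_.NumberField.Units _root_.NumberField.Units.dirichletUnitTheorem
open Module
open Literature.Geometry.Kaehler.ComplexTorus.HilbertModularFamily
open Literature.NumberTheory.Automorphic (HilbertModular.deRhamCohomology.mk HilbertModular.deRhamCohomology.mk_eq_mk_iff)

variable {F : Type*} [Field F] [NumberField F] [IsTotallyReal F]

/-! ## §1 The sector character -/

section Character

variable {k : ℕ}

/-- **The character of a sector**: `sectorChar I ε = Π_{σ ∈ I} σ(ε)`, by which `z ↦ εz + b` acts on `dx_I`.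
[cite: Freitag1990, Ch. III §2, p. 145] -/
def sectorChar (I : Finset (F →+* ℝ)) (ε : F) : ℝ :=
  ∏ σ ∈ I, σ ε

omit [NumberField F] [IsTotallyReal F] in
/-- Unfolding of `sectorChar`. [cite: Freitag1990, Ch. III §2, p. 145] -/
theorem sectorChar_apply (I : Finset (F →+* ℝ)) (ε : F) : sectorChar I ε = ∏ σ ∈ I, σ ε :=
  rfl

omit [IsTotallyReal F] in
/-- **The character of the symbol list of `t` is the character of its sector**:
`Π_i charFactor ε (c_i) = sectorChar (xPart t) ε`. [cite: Freitag1990, Ch. III §2, p. 145] -/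
theorem prod_charFactor_frameSymbols (t : FrameIdx F k) (ε : F) :
    ∏ i, charFactor ε (frameSymbols t i) = sectorChar (xPart t) ε := by
  rw [← Finset.prod_image (s := Finset.univ) (g := frameSymbols t) (f := charFactor ε)
    (fun i _ j _ h => frameSymbols_injective t h)]
  rw [← Finset.prod_filter_mul_prod_filter_not (Finset.univ.image (frameSymbols t)) (fun s => ∃ σ, s = Sum.inl σ)]
  have h2 : ∏ s ∈ (Finset.univ.image (frameSymbols t)).filter (fun s => ¬ ∃ σ, s = Sum.inl σ), charFactor ε s = 1 :=
    Finset.prod_eq_one fun s hs => by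
      obtain ⟨-, hs'⟩ := Finset.mem_filter.1 hs
      cases s with
      | inl σ => exact absurd ⟨σ, rfl⟩ hs'
      | inr σ => rfl
  rw [h2, mul_one, sectorChar_apply]
  have hset : (Finset.univ.image (frameSymbols t)).filter (fun s => ∃ σ, s = Sum.inl σ) = (xPart t).image Sum.inl := by
    ext s
    simp only [Finset.mem_filter, Finset.mem_image, Finset.mem_univ, true_and, mem_xPart_iff, Set.mem_range]
    constructor
    · rintro ⟨⟨i, hi⟩, σ, rfl⟩; exact ⟨σ, ⟨i, hi⟩, rfl⟩
    · rintro ⟨σ, ⟨i, hi⟩, rfl⟩; exact ⟨⟨i, hi⟩, σ, rfl⟩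
  rw [hset, Finset.prod_image fun σ _ τ _ h => Sum.inl_injective h]
  simp

omit [NumberField F] [IsTotallyReal F] in
/-- The sector character of a totally positive element is positive. [cite: Freitag1990, Ch. I §2 Remark 2.3, p. 27] -/
theorem sectorChar_pos {ε : F} (hε : ∀ σ : F →+* ℝ, 0 < σ ε) (I : Finset (F →+* ℝ)) : 0 < sectorChar I ε :=
  Finset.prod_pos fun σ _ => hε σ

end Character

/-! ## §2 The dilation by a multiplier on the sector pieces -/

section Dilation

variable {Γ : Subgroup SL(2, F)} {k : ℕ}

/-- The logarithmic embedding vector of `ε`: `ℓ_σ = log σ(ε)`. [cite: Freitag1990, Ch. I §2 2.4, p. 28] -/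
def logEmb (ε : F) : (F →+* ℝ) → ℝ := fun σ => Real.log (σ ε)

omit [NumberField F] [IsTotallyReal F] in
/-- `logEmb ε σ = log σ(ε)`. [cite: Freitag1990, Ch. I §2 2.4, p. 28] -/
@[simp] theorem logEmb_apply (ε : F) (σ : F →+* ℝ) : logEmb ε σ = Real.log (σ ε) := rfl

omit [NumberField F] [IsTotallyReal F] in
/-- All embeddings of a multiplier `ε = e²` are positive. [cite: Freitag1990, Ch. I §2 Remark 2.3, p. 27] -/
theorem emb_sq_pos (e : Fˣ) (σ : F →+* ℝ) : 0 < σ ((e ^ 2 : Fˣ) : F) := by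
  rw [Units.val_pow_eq_pow_val, map_pow]
  have h : σ (e : F) ≠ 0 := (map_ne_zero σ).2 (Units.ne_zero e)
  exact lt_of_le_of_ne (sq_nonneg _) (Ne.symm (pow_ne_zero 2 h))

omit [IsTotallyReal F] in
/-- **The dilation by a multiplier differs from `z ↦ εz + em` by a real translation**:
`δ_{log ε} z = (e m; 0 e⁻¹) z + b` with `b_σ = (1 − σ(ε)) Re z_σ − σ(em)` real (`ε = e²`).
[cite: Freitag1990, Ch. III §2, p. 145] -/
theorem dilateL_logEmb_eq (e : Fˣ) (m : F) (z : Point F) :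
    dilateL (logEmb ((e ^ 2 : Fˣ) : F)) z = moeb (upperTri e m) z +
      realToPoint F (fun σ => (1 - σ ((e ^ 2 : Fˣ) : F)) * (z σ).re - σ ((e : F) * m)) := by
  funext σ
  rw [dilateL_apply, logEmb_apply, Real.exp_log (emb_sq_pos e σ), Pi.add_apply, moeb_upperTri_eq, Pi.add_apply,
    scalePoint_apply, realToPoint_apply, realToPoint_apply, embVec_apply]
  apply Complex.ext
  · simp; ring
  · simp

omit [IsTotallyReal F] in
/-- **The coefficients of an `x`-independent `Γ_∞`-invariant form under the dilation by a multiplier**: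
`f_t(δ_{log ε} z) = (sectorChar (xPart t) ε)⁻¹ · f_t(z)` for `z ∈ ℍⁿ`, `ε = e²`, `(e m; 0 e⁻¹) ∈ Γ`.
[cite: Freitag1990, Ch. III §2, p. 145] -/
theorem formCoeff_dilateL_logEmb {α : Form F k} (hα : α ∈ invariantForms (stabInfty Γ) k)
    (hαx : ∀ z x, α (z + realToPoint F x) = α z) {e : Fˣ} {m : F} (hγ : upperTri e m ∈ Γ) (t : FrameIdx F k)
    {z : Point F} (hz : z ∈ halfSpace F) :
    formCoeff α t (dilateL (logEmb ((e ^ 2 : Fˣ) : F)) z) =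
      (((sectorChar (xPart t) ((e ^ 2 : Fˣ) : F))⁻¹ : ℝ) : ℂ) * formCoeff α t z := by
  have hinv : moebPullback (upperTri e m) α z = α z :=
    (mem_invariantForms_iff.1 hα).2.1 _ ⟨hγ, upperTri_apply_one_zero e m⟩ z hz
  have h := formCoeff_moebPullback_upperTri α e m t z
  rw [formCoeff_apply, hinv, ← formCoeff_apply, prod_charFactor_frameSymbols, Complex.real_smul] at h
  have hχ : (sectorChar (xPart t) ((e ^ 2 : Fˣ) : F) : ℂ) ≠ 0 := by
    exact_mod_cast (sectorChar_pos (emb_sq_pos e) _).ne'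
  rw [dilateL_logEmb_eq e m z, formCoeff_add_realToPoint hαx, h, ← mul_assoc, Complex.ofReal_inv, inv_mul_cancel₀ hχ,
    one_mul]

omit [IsTotallyReal F] in
/-- **`δ_{log ε}^* ω_I = (sectorChar I ε)⁻¹ • ω_I`** for the sector pieces of an `x`-independent `Γ_∞`-invariant form and
a multiplier `ε = e²`, `(e m; 0 e⁻¹) ∈ Γ`. [cite: Freitag1990, Ch. III §2, proof of Prop. 2.1, p. 145] -/
theorem dilPullback_logEmb_sectorPiece {α : Form F k} (hα : α ∈ invariantForms (stabInfty Γ) k)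
    (hαx : ∀ z x, α (z + realToPoint F x) = α z) {e : Fˣ} {m : F} (hγ : upperTri e m ∈ Γ) (I : Finset (F →+* ℝ)) :
    dilPullback (logEmb ((e ^ 2 : Fˣ) : F)) (sectorPiece α I) =
      (((sectorChar I ((e ^ 2 : Fˣ) : F))⁻¹ : ℝ) : ℂ) • sectorPiece α I := by
  funext z
  by_cases hz : z ∈ halfSpace F
  · rw [Pi.smul_apply]
    refine eq_of_apply_frameTuple_eq hz fun t => ?_
    have hδz : dilateL (logEmb ((e ^ 2 : Fˣ) : F)) z ∈ halfSpace F := dilateL_mem_halfSpace _ hz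
    rw [← formCoeff_apply, formCoeff_dilPullback _ _ _ hz, formCoeff_sectorPiece α I t hδz,
      ContinuousAlternatingMap.smul_apply, ← formCoeff_apply, formCoeff_sectorPiece α I t hz]
    split_ifs with ht
    · rw [formCoeff_dilateL_logEmb hα hαx hγ t hz, ht, smul_eq_mul]
    · rw [smul_zero]
  · rw [dilPullback_of_not_mem _ _ hz, Pi.smul_apply, sectorPiece_of_not_mem α I hz, smul_zero]

end Dilation

/-! ## §3 Sector pieces with a non-trivial character are cohomologous to zero -/

section Kill

variable {Γ : Subgroup SL(2, F)} {k : ℕ}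

omit [IsTotallyReal F] in
/-- **THE CHARACTER KILL: `[ω_I] = 0` in `H^{k+1}((ℍⁿ, Γ_∞))` as soon as `sectorChar I ε ≠ 1` for a multiplier
`ε = e²`, `(e m; 0 e⁻¹) ∈ Γ`** — for an `x`-independent `ω ∈ closedForms Γ_∞`: `[ω_I] = [δ_{log ε}^* ω_I] = χ⁻¹ [ω_I]`.
[cite: Freitag1990, Ch. III §2, proof of Prop. 2.1, p. 145] -/
theorem mk_sectorPiece_eq_zero_of_sectorChar_ne_one {α : Form F (k + 1)} (hα : α ∈ closedForms (stabInfty Γ) (k + 1))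
    (hαx : ∀ z x, α (z + realToPoint F x) = α z) {e : Fˣ} {m : F} (hγ : upperTri e m ∈ Γ) {I : Finset (F →+* ℝ)}
    (hI : sectorChar I ((e ^ 2 : Fˣ) : F) ≠ 1) :
    HilbertModular.deRhamCohomology.mk (stabInfty Γ) (k + 1) ⟨sectorPiece α I, sectorPiece_mem_closedForms hα hαx I⟩ = 0 := by
  set β : closedForms (stabInfty Γ) (k + 1) := ⟨sectorPiece α I, sectorPiece_mem_closedForms hα hαx I⟩ with hβ_def
  set c : ℂ := (((sectorChar I ((e ^ 2 : Fˣ) : F))⁻¹ : ℝ) : ℂ) with hc_def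
  have h1 := mk_dilPullback_eq β (logEmb ((e ^ 2 : Fˣ) : F))
  have h2 : (⟨dilPullback (logEmb ((e ^ 2 : Fˣ) : F)) β, dilPullback_mem_closedForms β.2 _⟩ :
      closedForms (stabInfty Γ) (k + 1)) = c • β := by
    apply Subtype.ext
    exact dilPullback_logEmb_sectorPiece (closedForms_le_invariantForms _ _ hα) hαx hγ I
  rw [h2, map_smul] at h1
  have h3 : (c - 1) • HilbertModular.deRhamCohomology.mk (stabInfty Γ) (k + 1) β = 0 := by
    rw [sub_smul, one_smul, h1, sub_self]
  have hχ : 0 < sectorChar I ((e ^ 2 : Fˣ) : F) := sectorChar_pos (emb_sq_pos e) I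
  have hc : c - 1 ≠ 0 := by
    rw [sub_ne_zero, hc_def]
    intro h
    apply hI
    have h' : ((sectorChar I ((e ^ 2 : Fˣ) : F))⁻¹ : ℝ) = 1 := by exact_mod_cast h
    rw [inv_eq_one] at h'
    exact h'
  exact (smul_eq_zero.1 h3).resolve_left hc

omit [IsTotallyReal F] in
/-- **Only the sectors with trivial characters survive**: for an `x`-independent `ω ∈ closedForms Γ_∞ (k+1)`,
`[ω] = Σ_{I : sectorChar I ≡ 1 on the multipliers} [ω_I]`. [cite: Freitag1990, Ch. III §2, proof of Prop. 2.1, p. 145] -/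
theorem mk_eq_sum_filter_mk_sectorPiece {α : Form F (k + 1)} (hα : α ∈ closedForms (stabInfty Γ) (k + 1))
    (hαx : ∀ z x, α (z + realToPoint F x) = α z) :
    HilbertModular.deRhamCohomology.mk (stabInfty Γ) (k + 1) ⟨α, hα⟩ =
      ∑ I ∈ Finset.univ.filter (fun I : Finset (F →+* ℝ) => ∀ (e : Fˣ) (m : F), upperTri e m ∈ Γ →
        sectorChar I ((e ^ 2 : Fˣ) : F) = 1),
        HilbertModular.deRhamCohomology.mk (stabInfty Γ) (k + 1) ⟨sectorPiece α I, sectorPiece_mem_closedForms hα hαx I⟩ := by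
  rw [mk_eq_sum_mk_sectorPiece hα hαx, Finset.sum_filter_of_ne]
  intro I _ hI e m hγ
  by_contra hne
  exact hI (mk_sectorPiece_eq_zero_of_sectorChar_ne_one hα hαx hγ hne)

end Kill

/-! ## §4 The regulator step: only the sectors `∅` and `Hom(F, ℝ)` have trivial characters -/

section Regulator

variable {Γ : Subgroup SL(2, F)}

variable (F) in
/-- The real place of the distinguished infinite place `w₀`. [folklore] -/
private def basePlace : RealPlace F := ⟨w₀, IsTotallyReal.isReal _⟩

omit [NumberField F] [IsTotallyReal F] in
/-- `v(x) = |x^{(v)}|` for a real place. [folklore] -/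
private theorem realPlace_apply_eq_abs' (v : RealPlace F) (x : F) : v.1 x = |realEmb F v x| := by
  rw [← norm_embedding_eq, show (embedding v.1) x = ((realEmb F v x : ℝ) : ℂ) from
    (embedding_of_isReal_apply v.2 x).symm, Complex.norm_real, Real.norm_eq_abs]

/-- Every real place is `w₀` or `placeOf w` for a place `w ≠ w₀`. [folklore] -/
private theorem realPlace_eq_basePlace_or (v : RealPlace F) :
    v = basePlace F ∨ ∃ w : {w : InfinitePlace F // w ≠ w₀}, v = placeOf w := by
  by_cases h : v.1 = w₀
  · exact Or.inl (Subtype.ext h)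
  · exact Or.inr ⟨⟨v.1, h⟩, Subtype.ext rfl⟩

/-- A sum over the real places splits as the `w₀`-term plus the sum over the places `≠ w₀`. [folklore] -/
private theorem sum_realPlace_eq (g : RealPlace F → ℝ) :
    ∑ v, g v = g (basePlace F) + ∑ w : {w : InfinitePlace F // w ≠ w₀}, g (placeOf w) := by
  let e : RealPlace F ≃ InfinitePlace F := Equiv.subtypeUnivEquiv fun w : InfinitePlace F => IsTotallyReal.isReal w
  rw [← Fintype.sum_equiv e.symm (fun w => g (e.symm w)) g fun _ => rfl, ← Finset.add_sum_erase _ _ (Finset.mem_univ w₀),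
    Finset.sum_subtype (Finset.univ.erase w₀) (p := fun w => w ≠ w₀) (fun w => by simp)
      (f := fun w => g (e.symm w))]
  rfl

/-- The multiplier character functional vanishes identically: if `sectorChar I ε = 1` for every multiplier, then for
every place `w ≠ w₀`, `[realEmb (placeOf w) ∈ I] = [realEmb w₀ ∈ I]`. [cite: Freitag1990, Ch. III §2, p. 145; Ch. I §2
2.3–2.5, p. 28] -/
private theorem indicator_eq_of_forall_sectorChar_eq_one (hΓ : HasCuspInfty Γ) {I : Finset (F →+* ℝ)}
    (hI : ∀ (e : Fˣ) (m : F), upperTri e m ∈ Γ → sectorChar I ((e ^ 2 : Fˣ) : F) = 1)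
    (w : {w : InfinitePlace F // w ≠ w₀}) :
    (if realEmb F (placeOf w) ∈ I then (1 : ℝ) else 0) = if realEmb F (basePlace F) ∈ I then 1 else 0 := by
  -- the coefficients of the functional
  set c : {w : InfinitePlace F // w ≠ w₀} → ℝ := fun w =>
    (if realEmb F (placeOf w) ∈ I then (1 : ℝ) else 0) - if realEmb F (basePlace F) ∈ I then 1 else 0 with hc_def
  set L : logSpace F →ₗ[ℝ] ℝ :=
    { toFun := fun ℓ => ∑ w, c w * ℓ w
      map_add' := fun ℓ ℓ' => by simp only [Pi.add_apply, mul_add, Finset.sum_add_distrib]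
      map_smul' := fun r ℓ => by
        simp only [Pi.smul_apply, smul_eq_mul, RingHom.id_apply, Finset.mul_sum]
        exact Finset.sum_congr rfl fun w _ => by ring } with hL_def
  -- `L` vanishes on `log Λ(Γ)`
  have hLat : ∀ v ∈ logMultiplierLattice Γ, L v = 0 := by
    intro v hv
    obtain ⟨u, hu, rfl⟩ := (mem_logMultiplierLattice_iff Γ v).1 hv
    set ε : Fˣ := Units.map (algebraMap (𝓞 F) F : 𝓞 F →* F) u with hε_def
    have hε : ε ∈ multiplierGroup Γ := (mem_multiplierUnits_iff Γ u).1 hu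
    obtain ⟨e, m, hγ, hεe⟩ := (mem_multiplierGroup_iff Γ ε).1 hε
    have hpos : ∀ v : RealPlace F, 0 < realEmb F v (ε : F) := fun v => realEmb_pos_of_mem_multiplierGroup hε v
    have hlog : ∀ w : {w : InfinitePlace F // w ≠ w₀},
        logEmbedding F (Additive.ofMul u) w = Real.log (realEmb F (placeOf w) (ε : F)) := fun w => by
      rw [logEmbedding_component, IsTotallyReal.mult_eq, Nat.cast_one, one_mul]
      show Real.log (w.1 ((u : 𝓞 F) : F)) = _
      rw [show w.1 = (placeOf w).1 from rfl, realPlace_apply_eq_abs' (placeOf w),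
        show (((u : (𝓞 F)ˣ) : 𝓞 F) : F) = (ε : F) from rfl, abs_of_pos (hpos _)]
    -- `Σ_v log ε^{(v)} = 0`
    have hsum0 : Real.log (realEmb F (basePlace F) (ε : F)) +
        ∑ w : {w : InfinitePlace F // w ≠ w₀}, Real.log (realEmb F (placeOf w) (ε : F)) = 0 := by
      rw [← sum_realPlace_eq (fun v => Real.log (realEmb F v (ε : F))), ← Real.log_prod (s := Finset.univ)
        (f := fun v => realEmb F v (ε : F)) (fun v _ => (hpos v).ne'), hΓ.prod_realEmb_eq_one hε, Real.log_one]
    -- `Σ_{σ ∈ I} log σ(ε) = 0`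
    have hchar : ∑ v : RealPlace F, (if realEmb F v ∈ I then (1 : ℝ) else 0) * Real.log (realEmb F v (ε : F)) = 0 := by
      have h1 : ∑ v : RealPlace F, (if realEmb F v ∈ I then (1 : ℝ) else 0) * Real.log (realEmb F v (ε : F)) =
          ∑ σ : F →+* ℝ, (if σ ∈ I then (1 : ℝ) else 0) * Real.log (σ (ε : F)) :=
        Fintype.sum_equiv (realPlaceEquiv F) _ _ fun v => by rw [realPlaceEquiv_apply]
      rw [h1]
      simp only [ite_mul, one_mul, zero_mul, Finset.sum_ite_mem, Finset.univ_inter]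
      rw [← Real.log_prod (s := I) (f := fun σ => σ (ε : F)) fun σ _ => ?_, ← sectorChar_apply, hεe, hI e m hγ, Real.log_one]
      rw [← realEmb_realPlaceEquiv_symm (F := F) σ]
      exact (hpos _).ne'
    rw [sum_realPlace_eq (fun v => (if realEmb F v ∈ I then (1 : ℝ) else 0) * Real.log (realEmb F v (ε : F)))] at hchar
    -- assemble
    show ∑ w, c w * logEmbedding F (Additive.ofMul u) w = 0
    simp only [hlog, hc_def, sub_mul, Finset.sum_sub_distrib, ← Finset.mul_sum]
    have hb : ∑ w : {w : InfinitePlace F // w ≠ w₀}, Real.log (realEmb F (placeOf w) (ε : F)) =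
        -Real.log (realEmb F (basePlace F) (ε : F)) := by linarith
    rw [hb]
    linarith
  -- hence on the whole logarithmic space
  have hL0 : L = 0 := by
    have hle : (⊤ : Submodule ℝ (logSpace F)) ≤ LinearMap.ker L := by
      rw [← hΓ.span_logMultiplierLattice_eq_top, Submodule.span_le]
      intro v hv
      exact (LinearMap.mem_ker).2 (hLat v hv)
    ext v
    exact (LinearMap.mem_ker).1 (hle Submodule.mem_top)
  have h := congrArg (fun L' : logSpace F →ₗ[ℝ] ℝ => L' (Pi.single w 1)) hL0
  simp only [hL_def, LinearMap.coe_mk, AddHom.coe_mk, LinearMap.zero_apply, Pi.single_apply, mul_ite, mul_one, mul_zero,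
    Finset.sum_ite_eq', Finset.mem_univ, if_true] at h
  rw [hc_def] at h
  exact sub_eq_zero.1 h

/-- **The regulator step: if `Π_{σ ∈ I} σ(ε) = 1` for every multiplier `ε` of a group with cusp `∞`, then `I = ∅` or
`I = Hom(F, ℝ)`** — `log Λ` spans the trace-zero hyperplane, so a coordinate functional vanishing on it is a multiple of
the trace. [cite: Freitag1990, Ch. III §2, proof of Prop. 2.1, p. 145 («only … `a = ∅` … or `a = {1, …, n}`»); Ch. I §2
2.3–2.5, p. 28] -/
theorem eq_empty_or_eq_univ_of_forall_sectorChar_eq_one (hΓ : HasCuspInfty Γ) {I : Finset (F →+* ℝ)}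
    (hI : ∀ (e : Fˣ) (m : F), upperTri e m ∈ Γ → sectorChar I ((e ^ 2 : Fˣ) : F) = 1) :
    I = ∅ ∨ I = Finset.univ := by
  have key : ∀ σ : F →+* ℝ, σ ∈ I ↔ realEmb F (basePlace F) ∈ I := fun σ => by
    rcases realPlace_eq_basePlace_or ((realPlaceEquiv F).symm σ) with h | ⟨w, hw⟩
    · rw [← realEmb_realPlaceEquiv_symm (F := F) σ, h]
    · have h1 := indicator_eq_of_forall_sectorChar_eq_one hΓ hI w
      rw [← hw, realEmb_realPlaceEquiv_symm] at h1
      by_cases hσ : σ ∈ I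
      · rw [if_pos hσ] at h1
        by_cases h0 : realEmb F (basePlace F) ∈ I
        · exact ⟨fun _ => h0, fun _ => hσ⟩
        · rw [if_neg h0] at h1; exact absurd h1 one_ne_zero
      · rw [if_neg hσ] at h1
        by_cases h0 : realEmb F (basePlace F) ∈ I
        · rw [if_pos h0] at h1; exact absurd h1.symm one_ne_zero
        · exact ⟨fun h => absurd h hσ, fun h => absurd h h0⟩
  by_cases h0 : realEmb F (basePlace F) ∈ I
  · exact Or.inr (Finset.eq_univ_of_forall fun σ => (key σ).2 h0)
  · exact Or.inl (Finset.eq_empty_of_forall_notMem fun σ hσ => h0 ((key σ).1 hσ))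

/-- **`[ω] = [ω_∅] + [ω_{Hom(F,ℝ)}]` in `H^{k+1}((ℍⁿ, Γ_∞))`** for an `x`-independent `ω ∈ closedForms Γ_∞` of a
group with cusp `∞` (and `n ≥ 1`): the mixed sectors are killed by the characters.
[cite: Freitag1990, Ch. III §2, proof of Prop. 2.1, p. 145] -/
theorem mk_eq_mk_sectorPiece_empty_add_univ (hΓ : HasCuspInfty Γ) {k : ℕ} {α : Form F (k + 1)}
    (hα : α ∈ closedForms (stabInfty Γ) (k + 1)) (hαx : ∀ z x, α (z + realToPoint F x) = α z) :
    HilbertModular.deRhamCohomology.mk (stabInfty Γ) (k + 1) ⟨α, hα⟩ =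
      HilbertModular.deRhamCohomology.mk (stabInfty Γ) (k + 1) ⟨sectorPiece α ∅, sectorPiece_mem_closedForms hα hαx ∅⟩ +
        HilbertModular.deRhamCohomology.mk (stabInfty Γ) (k + 1)
          ⟨sectorPiece α Finset.univ, sectorPiece_mem_closedForms hα hαx Finset.univ⟩ := by
  rw [mk_eq_sum_filter_mk_sectorPiece hα hαx]
  have hne : (∅ : Finset (F →+* ℝ)) ≠ Finset.univ := by
    obtain ⟨σ⟩ : Nonempty (F →+* ℝ) := ⟨realEmb F (basePlace F)⟩
    intro h
    exact absurd (h ▸ Finset.mem_univ σ) (Finset.notMem_empty σ)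
  have hsub : Finset.univ.filter (fun I : Finset (F →+* ℝ) => ∀ (e : Fˣ) (m : F), upperTri e m ∈ Γ →
      sectorChar I ((e ^ 2 : Fˣ) : F) = 1) ⊆ {∅, Finset.univ} := fun I hI => by
    rcases eq_empty_or_eq_univ_of_forall_sectorChar_eq_one hΓ (Finset.mem_filter.1 hI).2 with h | h <;> simp [h]
  rw [Finset.sum_subset hsub fun I hI hI' => ?_, Finset.sum_pair hne]
  -- the terms outside the filter vanish: the filter condition fails, so some character is `≠ 1`
  have h' : ¬ ∀ (e : Fˣ) (m : F), upperTri e m ∈ Γ → sectorChar I ((e ^ 2 : Fˣ) : F) = 1 := fun h =>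
    hI' (Finset.mem_filter.2 ⟨Finset.mem_univ _, h⟩)
  obtain ⟨e, he⟩ := not_forall.1 h'
  obtain ⟨m, hm⟩ := not_forall.1 he
  obtain ⟨hγ, hχ⟩ := Classical.not_imp.1 hm
  exact mk_sectorPiece_eq_zero_of_sectorChar_ne_one hα hαx hγ hχ

end Regulator

end Literature.NumberTheory.Automorphic.HilbertModular
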